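import Literature.Computability.AlgebraicComplexity.PartialMatrixMultiplicationProofs
import Literature.Computability.AlgebraicComplexity.OmegaScalarExtensionInvariance
import Mathlib.FieldTheory.IsAlgClosed.AlgebraicClosure
import HarnessLib

/-!
# Schönhage's partial matrix multiplication theorem over EVERY field (BCS Thm. (15.48) as printed)

Topic `Literature/Computability/AlgebraicComplexity`. Bürgisser–Clausen–Shokrollahi 1997,
Thm. (15.48) (Schönhage): "assume `R̲(⟨E, H, L⟩_{I,J}) ≤ r` for `r ∈ ℕ`. Then
`(∑_{j∈ν} m_j p_j dim H_j)^{ω/3} ≤ r`" — stated for an ARBITRARY field `k`, the printed proof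
beginning "By Cor. (15.18) we may assume that `k` is infinite." The tree's named fact
`Schonhage1981_partialMatMul` (`PartialMatrixMultiplication.lean`) and its discharge
`Schonhage1981_partialMatMul_holds` (`PartialMatrixMultiplicationProofs.lean`) carry the hypothesis
`[Infinite K]`; with Cor. (15.18) now in the tree in full generality (`BCS1997_cor_15_18`,
`OmegaScalarExtensionInvariance.lean`) this file performs exactly the printed reduction and removes
it:

* `approxRank_map_le`, `algBorderRank_map_le` — approximate decompositions map along any ring
  homomorphism `f : K → L`: `R_h(f ∘ t) ≤ R_h(t)`, `R̲(f ∘ t) ≤ R̲(t)` (BCS (15.14)/(15.26) for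
  border rank; the tree had the special case `algBorderRank_matMulTensor_le_of_ringHom`).
* `partialMatMulTensor_map` — `⟨e,h,l⟩_{I,J}` has entries `0, 1`.
* `BCS1997_thm_15_48` — **Thm. (15.48) over every field**: `R̲(⟨e,h,l⟩_{I,J}) ≤ r ⇒ f^{ω(K)/3} ≤ r`
  (`f` = the filling), by passage to the algebraic closure `K̄` (infinite), where
  `Schonhage1981_partialMatMul_holds` applies, `R̲` does not increase and `ω(K̄) = ω(K)`.
* `BCS1997_thm_15_48_rank`, `BCS1997_thm_15_48_omega_le` — rank form and logarithmic form
  `ω ≤ 3 log_f r` over every field.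

Everything is proved; no definitions, no named facts.

## References

* [BurgisserClausenShokrollahi1997] P. Bürgisser, M. Clausen, M. A. Shokrollahi, *Algebraic
  Complexity Theory*, Grundlehren 315, Springer 1997 — Thm. (15.48) and its proof ("By Cor. (15.18)
  we may assume that `k` is infinite"), Cor. (15.18), (15.26).
* [Schonhage1981] A. Schönhage, *Partial and total matrix multiplication*, SIAM J. Comput. 10
  (1981) 434–455, Thm. 4.1.
-/

noncomputable section

open scoped BigOperators Polynomial

namespace Literature.Computability.AlgebraicComplexity

universe u v

/-! ## Border rank does not increase under scalar extension -/

section Map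

variable {K : Type u} {L : Type v} [Field K] [Field L]
variable {ι κ μ : Type*} [Fintype ι] [Fintype κ] [Fintype μ]
variable [DecidableEq ι] [DecidableEq κ] [DecidableEq μ]

/-- **`R_h(f ∘ t) ≤ R_h(t)`**: an order-`h` approximate decomposition over `K[ε]` maps, coefficient
by coefficient, to one over `L[ε]` along any ring homomorphism `f : K → L` (BCS (15.26):
`φ ⊴_q ψ ⇒ φ^K ⊴_q ψ^K` under scalar extension). [cite: BurgisserClausenShokrollahi1997, (15.26)] -/
theorem approxRank_map_le (f : K →+* L) (h : ℕ) (t : ι → κ → μ → K) :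
    approxRank h (fun a b c => f (t a b c)) ≤ approxRank h t := by
  classical
  have hne : {r : ℕ | ∃ (u : Fin r → ι → K[X]) (v : Fin r → κ → K[X]) (w : Fin r → μ → K[X]),
      IsApproxDecomposition h t u v w}.Nonempty := by
    obtain ⟨r, u, v, w, huvw⟩ := exists_isApproxDecomposition h t
    exact ⟨r, u, v, w, huvw⟩
  obtain ⟨u, v, w, huvw⟩ := Nat.sInf_mem hne
  unfold approxRank
  refine approxRank_le_of_isApproxDecomposition (u := fun ρ i => (u ρ i).map f)
    (v := fun ρ i => (v ρ i).map f) (w := fun ρ i => (w ρ i).map f) ?_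
  intro x y z j hj
  have hsum : (∑ ρ, (u ρ x).map f * (v ρ y).map f * (w ρ z).map f) =
      (∑ ρ, u ρ x * v ρ y * w ρ z).map f := by
    rw [Polynomial.map_sum]
    simp [Polynomial.map_mul]
  rw [hsum, Polynomial.coeff_map, huvw x y z j hj]
  simp only [apply_ite f, map_zero]

/-- **`R̲_L(f ∘ t) ≤ R̲_K(t)`**: border rank does not increase under scalar extension along any
ring homomorphism `f : K → L` (BCS (15.26)/(15.14)). [cite: BurgisserClausenShokrollahi1997, (15.26)] -/
theorem algBorderRank_map_le (f : K →+* L) (t : ι → κ → μ → K) :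
    algBorderRank (fun a b c => f (t a b c)) ≤ algBorderRank t :=
  le_ciInf fun h => (ciInf_le (OrderBot.bddBelow _) h).trans (approxRank_map_le f h t)

end Map

/-! ## Thm. (15.48) over every field -/

section PartialMatMul

variable {K : Type u} {L : Type v} [Field K] [Field L]

/-- The partial matrix multiplication tensor `⟨e,h,l⟩_{I,J}` has entries `0, 1`, hence is its own
scalar extension: `f ∘ ⟨e,h,l⟩_{I,J}^K = ⟨e,h,l⟩_{I,J}^L`.
[cite: BurgisserClausenShokrollahi1997, §15.9 (partial matrix multiplication of pattern (I,J))] -/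
theorem partialMatMulTensor_map (f : K →+* L) (e h l : ℕ) (I : Finset (Fin e × Fin h))
    (J : Finset (Fin h × Fin l)) :
    (fun a b c => f (partialMatMulTensor K e h l I J a b c)) = partialMatMulTensor L e h l I J := by
  funext a b c
  have hm : f (matMulTensor K e h l a b c) = matMulTensor L e h l a b c :=
    congrFun (congrFun (congrFun (matMulTensor_map f e h l) a) b) c
  simp only [partialMatMulTensor, apply_ite f, map_zero, hm]

/-- **BCS 1997, Thm. (15.48) (Schönhage's partial matrix multiplication theorem) over EVERY field**:
if `R̲(⟨e,h,l⟩_{I,J}) ≤ r` then `f^{ω(K)/3} ≤ r`, `f = #{(i,j,k) : (i,j) ∈ I, (j,k) ∈ J}` the filling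
— the tree's `Schonhage1981_partialMatMul_holds` without its `[Infinite K]` hypothesis, by the
printed reduction "By Cor. (15.18) we may assume that `k` is infinite": pass to the algebraic
closure `K̄` (infinite), where `R̲` has not increased (`algBorderRank_map_le`) and `ω(K̄) = ω(K)`
(`BCS1997_cor_15_18`). [cite: BurgisserClausenShokrollahi1997, Thm. (15.48)] -/
theorem BCS1997_thm_15_48 (K : Type) [Field K] (e h l : ℕ) (I : Finset (Fin e × Fin h))
    (J : Finset (Fin h × Fin l)) (r : ℕ)
    (hbR : algBorderRank (partialMatMulTensor K e h l I J) ≤ r) :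
    (filling e h l I J : ℝ) ^ (omega K / 3) ≤ r := by
  have hb : algBorderRank (partialMatMulTensor (AlgebraicClosure K) e h l I J) ≤ r := by
    rw [← partialMatMulTensor_map (algebraMap K (AlgebraicClosure K))]
    exact (algBorderRank_map_le _ _).trans hbR
  have key := Schonhage1981_partialMatMul_holds (AlgebraicClosure K) e h l I J r hb
  rwa [← BCS1997_cor_15_18 (algebraMap K (AlgebraicClosure K))] at key

/-- **Rank form over every field**: `f^{ω/3} ≤ R(⟨e,h,l⟩_{I,J})`.
[cite: BurgisserClausenShokrollahi1997, Thm. (15.48)] -/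
theorem BCS1997_thm_15_48_rank (K : Type) [Field K] (e h l : ℕ) (I : Finset (Fin e × Fin h))
    (J : Finset (Fin h × Fin l)) :
    (filling e h l I J : ℝ) ^ (omega K / 3) ≤ tensorRank (partialMatMulTensor K e h l I J) :=
  BCS1997_thm_15_48 K e h l I J _ (algBorderRank_le_tensorRank _)

/-- **Logarithmic form over every field**: for filling `f ≥ 2` and `R̲(⟨e,h,l⟩_{I,J}) ≤ r`,
`ω(K) ≤ 3 log_f r` (e.g. Ex. (15.50): `f = 6`, `r = 5`, `ω < 2.70`, now for every field).
[cite: BurgisserClausenShokrollahi1997, Thm. (15.48) and Ex. (15.50)] -/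
theorem BCS1997_thm_15_48_omega_le (K : Type) [Field K] {e h l : ℕ} {I : Finset (Fin e × Fin h)}
    {J : Finset (Fin h × Fin l)} {r : ℕ} (hf : 2 ≤ filling e h l I J)
    (hbR : algBorderRank (partialMatMulTensor K e h l I J) ≤ r) :
    omega K ≤ 3 * Real.logb (filling e h l I J) r := by
  have key := BCS1997_thm_15_48 K e h l I J r hbR
  have hf' : (1 : ℝ) < filling e h l I J := by exact_mod_cast hf
  have hfpos : (0 : ℝ) < filling e h l I J := by linarith
  have hlogf : 0 < Real.log (filling e h l I J) := Real.log_pos hf'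
  have hlog := Real.log_le_log (Real.rpow_pos_of_pos hfpos _) key
  rw [Real.log_rpow hfpos] at hlog
  have h2 : omega K / 3 ≤ Real.log r / Real.log (filling e h l I J) := (le_div_iff₀ hlogf).2 hlog
  rw [Real.logb]
  linarith

end PartialMatMul

end Literature.Computability.AlgebraicComplexity

end
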